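import Summits.BirchSwinnertonDyer.BirchSwinnertonDyer.Theorems.AdditiveBranchIMCGordTwoRankOneVisibility
import Summits.BirchSwinnertonDyer.Rank1Residual.GaloisImage.CongruenceVisibilityWitness
import Literature.NumberTheory.EllipticCurves.ComplexMultiplicationCoatesWilesReductionIndexProofs
import Literature.NumberTheory.EllipticCurves.CanonicalPAdicHeightThetaProofs
import Mathlib.NumberTheory.Padics.HeightOneSpectrum
import HarnessLib

/-!
# Route `SemiOrdinaryEisensteinDescent`, crux #2″ `WildSplitEisensteinValueAtOneV` (E_𝟙^V, stmt-BirchSwinnertonDyer-26610):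
# the ONE-WITNESS + OWN-POINT visibility door — `Ш(E)[p] ≠ 0` from ONE partner point and ONE rational point of `E`
# that is NOT locally `p`-divisible at a place where the partner point IS (cell `pub/bsd-wall`, width seat
# `bsd-wall-soed-p1-w3` g21; `--supports stmt-BirchSwinnertonDyer-26610`; THEOREMS ONLY; Theses-free; cell-free)

WHY. Modulo the print binders and the rank-zero leaf of the route's `closes`, crux #2″ is «`Typed.MissingLowerBoundAt W 3`
for every cell curve `W`» (w3 g14, `…WildSplitEisensteinValueAtOneVLowerHalf`); in Cremona's range exactly nine curves carry
content and every one of them has a `3`-congruent partner `F` of Mordell–Weil rank `3` (w3 g20,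
`Cruxes/WildSplitEisensteinInclusionAtThree/E1V-VISIBLE-NINE-w3g20.md`). Five rows were kernel-recorded through the tree's
COUNTING door (`VisibleLowerHalf.missingLowerBoundAt_of_congr_of_places_of_analyticRank_one`) or b2b's TWO-WITNESS door
(`missingLowerBoundAt_rankOne_irr_of_twoWitnesses_locallyDivisible`). The four remaining rows (`350919k1`, `412317d1`,
`412587c1`, `459135f1`) have `F(ℚ₃)[3] ≅ ℤ/3`, so the count fails by EQUALITY (`3^{rank E}·#F(ℚ₃)[3]·3 = 27 ≮ 27`) and the
localisation `F(ℚ)/3 → F(ℚ₃)/3F(ℚ₃)` generically has a ONE-dimensional kernel where two witnesses are wanted. This file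
removes the obstruction with a third door that needs neither a count nor a second witness nor a rank certificate for `F`.

THE ARGUMENT (Cremona–Mazur visibility with the Mordell–Weil term of the TARGET made explicit). Let `E = W`, `F = W'`,
`θ : F[p] ⥲ E[p]` a `Γ_K`-isomorphism, `S` a finite set of finite places outside which both curves are good and `v ∤ p`,
`E(K)/pE(K)` CYCLIC (`E(K) = ℤG + pE(K)`; e.g. analytic rank one with `E[p]` irreducible, `exists_generator_rankOne_of_irr`),
`T ∈ F(K) ∖ pF(K)` with `θ_* κ'(T)` satisfying the local condition of `E` at every `v ∈ S`, and a `K`-field `L` (a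
completion) such that `T ∈ pF(L)` while some `G₀ ∈ E(K)` has `G₀ ∉ pE(L)`. Then `Ш(E/K)[p] ≠ 0`: the visible class
`f(T) ∈ Ш(E/K)[p]` (`VisibleWitness.torsionH1ToH1_h1Equiv_kummerMapTorsion_mem_sha`) is non-zero — were it zero,
`θ_* κ'(T) = κ(Q) = a·κ(G)`; restricting to `Γ_L` kills the left side (`T ∈ pF(L)`, criterion (a)), so `a·res_L κ(G) = 0`;
if `p ∤ a` then `res_L κ(G) = 0`, hence `res_L κ(G₀) = b·res_L κ(G) = 0`, hence `G₀ ∈ pE(L)` by the CONVERSE of criterion (a)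
(§1) — excluded; so `p ∣ a`, `θ_* κ'(T) = 0`, `T ∈ pF(K)` — excluded. No index, no count, no second witness, no rank of `F`.

* §1 (any field `K` of characteristic `0`, any perfect `K`-field `L`) `exists_smul_eq_baseChange_of_res_kummerMapTorsion_eq_zero`
  — the CONVERSE of n1011's criterion (a) `VisibleWitness.res_kummerMapTorsion_eq_zero_of_exists_smul_eq`: `res_L κ(P) = 0`
  iff `P ∈ nE(L)` (localisation of Kummer classes `res_kummerClassTorsion`, exactness of the local Kummer sequence
  `localKummerClass_eq_zero_iff`, Galois descent `exists_toGeomPoints_eq_of_forall_smul_eq` over `L`); and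
  `res_h1Equiv_eq_zero_of_res_eq_zero` — restriction to `Γ_L` commutes with `θ_*` on classes restricting to zero.
* §2 (number field `K`, odd `p`) `exists_sha_ne_zero_of_congr_of_witness_of_ownPoint` — the door.
* §3 (over `ℚ`, analytic rank one, `E[p]` irreducible) `exists_sha_ne_zero_rankOne_irr_of_witness_of_ownPoint` and
  `missingLowerBoundAt_rankOne_irr_of_witness_of_ownPoint` — binders `hCT hGZK` only; per-pair data `θ`, `S`, the local
  conditions of `θ_* κ'(T)` on `S` (to be discharged per place by the tree's criteria (a)/(i)–(v)), the separating place `v`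
  with `T ∈ pF(ℚ_v)` and `G₀ ∉ pE(ℚ_v)`, and the datum `ord_p #Ш_an ≤ 2`.
* §4 the kernel currency of `G₀ ∉ pE(ℚ_v)` at a GOOD prime `ℓ ∤ Δ_E` (any `ℓ`, also `ℓ = p`):
  `not_exists_smul_eq_toPadicPoint_of_reductionCert` / `…_baseChange_…` — if `p ∣ N_ℓ = #Ẽ(𝔽_ℓ)` and `(N_ℓ/p)·G₀` is affine with `x`-coordinate
  prime to `ℓ`, then `G₀|_{ℚ_v} ∉ p·E(ℚ_v)` (`N_ℓ · E(ℚ_ℓ) ⊆ E₁(ℚ_ℓ)`, tree `isInReductionKernel_reductionPointCount_nsmul`,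
  transported along Mathlib's `adicCompletion.padicEquiv`). The local twin of `X7VisibilityWitnessShape.not_mem_range_zsmul_of_reductionCert`.

HONEST FRAMING: tool theorems; per pair they close nothing by themselves (the congruence `θ`, the witness, the own point and
the local certificates are INPUTS); the crux stays research-open class-wide; BSD is not proved by any of this.

References: Cremona–Mazur 2000 §3 [CremonaMazur2000]; Agashe–Stein 2002 Lemma 3.6 [AgasheStein2002]; Silverman AEC VII.2.1,
VIII.§2, X.§4, X.4.14 [SilvermanAEC2009]; Gross 1991 §2 [GrossLMS1991]; Coates–Wiles 1977 §6 [CoatesWiles1977].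
-/

set_option autoImplicit false
-- the Theorems namespace of this sub repeats the summit name by design (D-0017 nested layout)
set_option linter.dupNamespace false

noncomputable section

open scoped Classical

open WeierstrassCurve Literature.NumberTheory.EllipticCurves
  Literature.NumberTheory.EllipticCurves.Rank1Residual
  Literature.NumberTheory.EllipticCurves.Rank1Residual.Typed
  Literature.NumberTheory.GaloisRepresentations
  Summit.BirchSwinnertonDyer.Rank1Residual.GaloisImage
open NumberField IsDedekindDomain Rat.HeightOneSpectrum Field

namespace Summit.BirchSwinnertonDyer.BirchSwinnertonDyer.Theorems.VisibleOwnPoint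

universe u

/-! ## §1 Localisation: the converse of criterion (a), and `res ∘ θ_*` on classes restricting to zero -/

section Localisation

variable {K : Type u} [Field K] [CharZero K] (W : WeierstrassCurve K) [W.IsElliptic] (L : Type u) [Field L]
  [Algebra K L] [PerfectField L] {n : ℤ}

/-- **Converse of criterion (a): a rational point whose Kummer class restricts to ZERO in `H¹(L, E[n])` is
`n`-divisible in `E(L)`** (`L` a perfect `K`-field, e.g. a completion). With `R ∈ E(K̄)` a chosen root `nR = P`, the
restriction of `κ(P)` to `Γ_L` is the local Kummer class of `R` read in `E(K̄_L)` (tree `res_kummerClassTorsion`); it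
vanishes iff `R − T'` is `Γ_L`-fixed for some `n`-torsion `T'` (`localKummerClass_eq_zero_iff`); a `Γ_L`-fixed point of
`E(K̄_L)` is an `L`-rational point `Q` (Galois descent over `L`, `exists_toGeomPoints_eq_of_forall_smul_eq` through
`baseChangeGeomPointsEquiv`), and `nQ = nR − nT' = P|_L`. Together with n1011's criterion (a) this is the exactness of
the local Kummer sequence at `E(L)/nE(L)` read on global classes. [cite: SilvermanAEC2009, VIII.§2 and X.§4 (diagram (**))] -/
theorem exists_smul_eq_baseChange_of_res_kummerMapTorsion_eq_zero (hn : n ≠ 0)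
    (hdiv : ∀ P : geomPoints W, ∃ Q : geomPoints W, n • Q = P) (P : W.toAffine.Point)
    (h : galoisCohomology.res (W.torsionGaloisModule n) L 1 (kummerMapTorsion W n hdiv P) = 0) :
    ∃ Q : (W.baseChange L).toAffine.Point,
      n • Q = WeierstrassCurve.Affine.Point.baseChange (W' := W) K L P := by
  rw [kummerMapTorsion_apply, kummerMapTorsionFun,
    res_kummerClassTorsion W n hn (zsmulRoot W n hdiv P) (zsmul_zsmulRoot_mem W n hdiv P)
      (zsmul_pointsMap_mem_fixedPoints W n _ (zsmul_zsmulRoot_mem W n hdiv P)),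
    localKummerClass_eq_zero_iff] at h
  obtain ⟨T', hT', hfix⟩ := h
  have hT0 : n • T' = 0 := hT'
  have hXfix : ∀ σ : absoluteGaloisGroup L,
      σ • (W.baseChangeGeomPointsEquiv L).symm (pointsMap W L (zsmulRoot W n hdiv P) - T') =
        (W.baseChangeGeomPointsEquiv L).symm (pointsMap W L (zsmulRoot W n hdiv P) - T') := by
    intro σ
    apply (W.baseChangeGeomPointsEquiv L).injective
    rw [baseChangeGeomPointsEquiv_smul, AddEquiv.apply_symm_apply]
    exact hfix σ
  obtain ⟨Q, hQ⟩ := exists_toGeomPoints_eq_of_forall_smul_eq (W.baseChange L) hXfix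
  refine ⟨Q, toGeomPoints_injective (W.baseChange L) ?_⟩
  apply (W.baseChangeGeomPointsEquiv L).injective
  rw [map_zsmul, hQ, map_zsmul, AddEquiv.apply_symm_apply, zsmul_sub, ← map_zsmul, zsmul_zsmulRoot, hT0,
    sub_zero, VisibleWitness.pointsMap_toGeomPoints_eq]

omit [CharZero K] [W.IsElliptic] [PerfectField L] in
/-- **Restriction to `Γ_L` commutes with `θ_*` on classes restricting to zero**: for a `Γ_K`-isomorphism
`θ : E'[n] ⥲ E[n]` and `c ∈ H¹(K, E'[n])` with `res_L c = 0`, also `res_L (θ_* c) = 0` (a cocycle `φ` with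
`φ|_{Γ_L} = ∂a` has `θ ∘ φ|_{Γ_L} = ∂(θa)`). [folklore] -/
theorem res_h1Equiv_eq_zero_of_res_eq_zero (W' : WeierstrassCurve K)
    (θ : geomTorsion W' n ≃+ geomTorsion W n)
    (hθ : ∀ (σ : absoluteGaloisGroup K) (P : geomTorsion W' n), θ (σ • P) = σ • θ P)
    (c : galH1Torsion W' n) (hc : galoisCohomology.res (W'.torsionGaloisModule n) L 1 c = 0) :
    galoisCohomology.res (W.torsionGaloisModule n) L 1 (h1Equiv θ hθ c) = 0 := by
  obtain ⟨φ, rfl⟩ :=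
    oneCocycleClass_surjective (discreteTopRep (absoluteGaloisGroup K) (geomTorsion W' n)) c
  rw [res_torsionGaloisModule_oneCocycleClass] at hc
  obtain ⟨a, ha⟩ := (oneCocycleClass_eq_zero_iff _ _).mp hc
  rw [h1Equiv_oneCocycleClass, res_torsionGaloisModule_oneCocycleClass]
  refine (oneCocycleClass_eq_zero_iff _ _).mpr ⟨θ a, fun σ ↦ ?_⟩
  have h1 : φ.1 (resGal (K := K) L σ) = resGal (K := K) L σ • a - a := ha σ
  change θ (φ.1 (resGal (K := K) L σ)) = resGal (K := K) L σ • θ a - θ a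
  rw [h1, map_sub, hθ]

end Localisation

/-! ## §2 The ONE-WITNESS + OWN-POINT visibility theorem (any number field `K`, odd `p`) -/

section Door

variable {K : Type} [Field K] [NumberField K] (W W' : WeierstrassCurve K) [W.IsElliptic]
  [W'.IsElliptic] {p : ℕ} [hp : Fact p.Prime]

/-- **Visibility with ONE witness and ONE own point.** Let `E = W`, `E' = W'` be elliptic curves over a number field
`K`, `p` an odd prime, `θ : E'[p] ⥲ E[p]` a `Γ_K`-equivariant isomorphism, `S` a finite set of finite places containing
every bad place of `E` or `E'` and every place above `p`, and suppose `E(K)/pE(K)` is CYCLIC (`E(K) = ℤG + pE(K)`).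
Let `T ∈ E'(K) ∖ pE'(K)` have transported Kummer class `θ_* κ'(T)` in the local condition of `E` at every `v ∈ S`, and let
`L = K_{v₀}` be the completion at ANY finite place `v₀` (inside or outside `S`) with `T ∈ p·E'(L)` and `G₀ ∉ p·E(L)`
for some `G₀ ∈ E(K)`. **Then `Ш(E/K)` has a non-zero element killed by `p`** — the visible class `f(T)`: if `f(T) = 0` then
`θ_* κ'(T) = κ(Q) = a·κ(G)` (`mem_range_kummerMapTorsion_of_torsionH1ToH1_eq_zero`); `res_L` of the left side vanishes
(criterion (a) and `res_h1Equiv_eq_zero_of_res_eq_zero`), so `a·res_L κ(G) = 0`; if `p ∤ a`, `res_L κ(G) = 0` (`up + wa = 1`,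
`κ(pG) = 0`), so `res_L κ(G₀) = b·res_L κ(G) = 0` and `G₀ ∈ pE(L)` (§1) — excluded; so `p ∣ a`, `θ_* κ'(T) = 0`, `T ∈ pE'(K)`
(`kummerMapTorsion_ker`) — excluded. Cremona–Mazur 2000 §3 / Agashe–Stein 2002 Lemma 3.6 with the Mordell–Weil term of the
target of dimension one, separated from the witness by ONE local Kummer coordinate. No index, no count, no rank of `E'`.
[cite: CremonaMazur2000, §3] [cite: AgasheStein2002, Lemma 3.6] -/
theorem exists_sha_ne_zero_of_congr_of_witness_of_ownPoint (hp2 : p ≠ 2)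
    (θ : geomTorsion W' (p : ℤ) ≃+ geomTorsion W (p : ℤ))
    (hθ : ∀ (σ : absoluteGaloisGroup K) (P : geomTorsion W' (p : ℤ)), θ (σ • P) = σ • θ P)
    (S : Finset (HeightOneSpectrum (𝓞 K)))
    (hS : ∀ v : HeightOneSpectrum (𝓞 K), v ∉ S →
      W.HasGoodReductionAt v ∧ W'.HasGoodReductionAt v ∧ (p : 𝓞 K) ∉ v.asIdeal)
    (hdiv' : ∀ P : geomPoints W', ∃ Q : geomPoints W', (p : ℤ) • Q = P)
    (hE : ∃ G : W.toAffine.Point, ∀ Q : W.toAffine.Point,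
      ∃ (a : ℤ) (R : W.toAffine.Point), Q = a • G + (p : ℤ) • R)
    (T : W'.toAffine.Point)
    (hT : T ∉ (zsmulAddGroupHom (p : ℤ) : W'.toAffine.Point →+ W'.toAffine.Point).range)
    (hloc : ∀ v ∈ S, h1Equiv θ hθ (kummerMapTorsion W' (p : ℤ) hdiv' T) ∈
      selmerLocalKer W (v.adicCompletion K) (p : ℤ))
    (v₀ : HeightOneSpectrum (𝓞 K))
    (hT₀ : ∃ Q : (W'.baseChange (v₀.adicCompletion K)).toAffine.Point,
      p • Q = WeierstrassCurve.Affine.Point.baseChange (W' := W') K (v₀.adicCompletion K) T)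
    (G₀ : W.toAffine.Point)
    (hG₀ : ¬ ∃ Q : (W.baseChange (v₀.adicCompletion K)).toAffine.Point,
      p • Q = WeierstrassCurve.Affine.Point.baseChange (W' := W) K (v₀.adicCompletion K) G₀) :
    ∃ c : W.sha, c ≠ 0 ∧ p • c = 0 := by
  -- the separating completion `L = K_{v₀}` is perfect (characteristic zero)
  haveI : CharZero (v₀.adicCompletion K) :=
    Literature.NumberTheory.GaloisRepresentations.charZero_adicCompletion v₀
  have hpp : p.Prime := Fact.out
  have hn : (p : ℤ) ≠ 0 := by exact_mod_cast hpp.ne_zero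
  have hdiv : ∀ P : geomPoints W, ∃ Q : geomPoints W, (p : ℤ) • Q = P :=
    W.zsmul_geomPoints_surjective_holds hn
  obtain ⟨hsha, hpc⟩ :=
    VisibleWitness.torsionH1ToH1_h1Equiv_kummerMapTorsion_mem_sha W W' hp2 θ hθ S hS hdiv' T hloc
  by_cases h0 : torsionH1ToH1 W (p : ℤ) (h1Equiv θ hθ (kummerMapTorsion W' (p : ℤ) hdiv' T)) = 0
  swap
  · exact ⟨⟨_, hsha⟩, fun h ↦ h0 (congrArg Subtype.val h), Subtype.ext hpc⟩
  exfalso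
  set κ := kummerMapTorsion W (p : ℤ) hdiv with hκ
  set κ' := kummerMapTorsion W' (p : ℤ) hdiv' with hκ'
  obtain ⟨Q, hQ⟩ := mem_range_kummerMapTorsion_of_torsionH1ToH1_eq_zero W (p : ℤ) hdiv _ h0
  obtain ⟨G, hG⟩ := hE
  obtain ⟨a, R, hR⟩ := hG Q
  obtain ⟨b, R', hR'⟩ := hG G₀
  -- `κ` kills `pE(K)`
  have hκp : ∀ R : W.toAffine.Point, κ ((p : ℤ) • R) = 0 := by
    intro R
    have hmem : (p : ℤ) • R ∈ κ.ker := by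
      rw [hκ, kummerMapTorsion_ker W (p : ℤ) hdiv]
      exact ⟨R, rfl⟩
    exact hmem
  have hκQ : κ Q = a • κ G := by rw [hR, map_add, map_zsmul, hκp, add_zero]
  have hκG₀ : κ G₀ = b • κ G := by rw [hR', map_add, map_zsmul, hκp, add_zero]
  -- the left side restricts to zero at `L`
  have hresT : galoisCohomology.res (W'.torsionGaloisModule (p : ℤ)) (v₀.adicCompletion K) 1 (κ' T) = 0 :=
    VisibleWitness.res_kummerMapTorsion_eq_zero_of_exists_smul_eq W' (v₀.adicCompletion K) hn hdiv' T
      (hT₀.imp fun Q' hQ' ↦ by rw [natCast_zsmul]; exact hQ')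
  -- the restriction `res_L : H¹(K, E[p]) → H¹(L, E[p])`, typed on `galH1Torsion` so that `map_add` / `map_zsmul` fire
  set r : galH1Torsion W (p : ℤ) →+
      galoisCohomology (GaloisRep.restrictField (v₀.adicCompletion K) (W.torsionGaloisModule (p : ℤ))) 1 :=
    galoisCohomology.res (W.torsionGaloisModule (p : ℤ)) (v₀.adicCompletion K) 1 with hr
  have hres : r (a • κ G) = 0 := by
    rw [← hκQ, hQ]
    exact res_h1Equiv_eq_zero_of_res_eq_zero W (v₀.adicCompletion K) W' θ hθ _ hresT
  by_cases hpa : (p : ℤ) ∣ a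
  · -- `p ∣ a`: `θ_* κ'(T) = a κ(G) = 0`, so `T ∈ pE'(K)`
    obtain ⟨m, hm⟩ := hpa
    have hT0 : κ' T = 0 := by
      apply (map_eq_zero_iff _ (h1Equiv θ hθ).injective).mp
      rw [← hQ, hκQ, hm, mul_comm, ← smul_smul, ← map_zsmul, hκp, zsmul_zero]
    have hmem : T ∈ κ'.ker := hT0
    rw [hκ', kummerMapTorsion_ker W' (p : ℤ) hdiv'] at hmem
    exact hT hmem
  · -- `p ∤ a`: `res_L κ(G) = 0`, so `res_L κ(G₀) = 0`, so `G₀ ∈ pE(L)`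
    have hprime : Prime (p : ℤ) := Nat.prime_iff_prime_int.mp hpp
    obtain ⟨u, w, huw⟩ := (Prime.coprime_iff_not_dvd hprime).mpr hpa
    have hresG : r (κ G) = 0 := by
      have hG1 : κ G = u • κ ((p : ℤ) • G) + w • (a • κ G) := by
        rw [map_zsmul, ← mul_zsmul, ← mul_zsmul, ← add_zsmul, huw, one_zsmul]
      rw [hG1, hκp, zsmul_zero, zero_add, map_zsmul, hres, zsmul_zero]
    have hresG₀ : r (κ G₀) = 0 := by
      rw [hκG₀, map_zsmul, hresG, zsmul_zero]
    obtain ⟨Q₀, hQ₀⟩ :=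
      exists_smul_eq_baseChange_of_res_kummerMapTorsion_eq_zero W (v₀.adicCompletion K) hn hdiv G₀ hresG₀
    exact hG₀ ⟨Q₀, by rw [← natCast_zsmul]; exact hQ₀⟩

end Door

/-! ## §3 The doors over `ℚ`: analytic rank one, `E[p]` irreducible (binders `hCT hGZK` only) -/

section RatDoors

open Summit.BirchSwinnertonDyer.BirchSwinnertonDyer.Theorems.AdditiveBranchIMCGordTwoRankOneVisibility

variable {W : WeierstrassCurve ℚ} [W.IsElliptic] {p : ℕ} [hp : Fact p.Prime]

/-- **`Ш(E)[p] ≠ 0` by one-witness + own-point visibility, `E/ℚ` of analytic rank one with `E[p]` irreducible, `p` odd.**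
GZK + irreducibility give the cyclicity of `E(ℚ)/pE(ℚ)` (`exists_generator_rankOne_of_irr`). Per-pair data (binders,
decided outside this file): the partner `W'`, the `Γ_ℚ`-isomorphism `θ : W'[p] ⥲ W[p]`, the finite set `S` (both curves
good and `w ∤ p` outside), ONE point `T ∈ W'(ℚ) ∖ pW'(ℚ)` with `θ_* κ'(T)` in the local condition of `W` at every
`w ∈ S` (criteria (a)/(i)–(v) of the tree, per place), a finite place `v` (in or outside `S`) with `T ∈ p·W'(ℚ_v)`, and
ONE point `G₀ ∈ W(ℚ)` with `G₀ ∉ p·W(ℚ_v)`. Per pair; NOT a class theorem. [cite: CremonaMazur2000, §3]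
[cite: AgasheStein2002, Lemma 3.6] [cite: GrossLMS1991, §2 (sentence after (2.2))] -/
theorem exists_sha_ne_zero_rankOne_irr_of_witness_of_ownPoint
    (hGZK : rank_eq_analyticRank_of_analyticRank_le_one) (hp2 : p ≠ 2)
    (hirr : Irr W p) (hr : W.analyticRank = 1)
    (W' : WeierstrassCurve ℚ) [W'.IsElliptic]
    (θ : geomTorsion W' (p : ℤ) ≃+ geomTorsion W (p : ℤ))
    (hθ : ∀ (σ : absoluteGaloisGroup ℚ) (P : geomTorsion W' (p : ℤ)), θ (σ • P) = σ • θ P)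
    (S : Finset (HeightOneSpectrum (𝓞 ℚ)))
    (hS : ∀ w : HeightOneSpectrum (𝓞 ℚ), w ∉ S →
      W.HasGoodReductionAt w ∧ W'.HasGoodReductionAt w ∧ (p : 𝓞 ℚ) ∉ w.asIdeal)
    (hdiv' : ∀ P : geomPoints W', ∃ Q : geomPoints W', (p : ℤ) • Q = P)
    (T : W'.toAffine.Point)
    (hT : T ∉ (zsmulAddGroupHom (p : ℤ) : W'.toAffine.Point →+ W'.toAffine.Point).range)
    (hloc : ∀ w ∈ S, h1Equiv θ hθ (kummerMapTorsion W' (p : ℤ) hdiv' T) ∈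
      selmerLocalKer W (w.adicCompletion ℚ) (p : ℤ))
    (v : HeightOneSpectrum (𝓞 ℚ))
    (hTv : ∃ Q : (W'.baseChange (v.adicCompletion ℚ)).toAffine.Point,
      p • Q = WeierstrassCurve.Affine.Point.baseChange (W' := W') ℚ (v.adicCompletion ℚ) T)
    (G₀ : W.toAffine.Point)
    (hG₀ : ¬ ∃ Q : (W.baseChange (v.adicCompletion ℚ)).toAffine.Point,
      p • Q = WeierstrassCurve.Affine.Point.baseChange (W' := W) ℚ (v.adicCompletion ℚ) G₀) :
    ∃ c : W.sha, c ≠ 0 ∧ p • c = 0 := by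
  obtain ⟨G, hG⟩ := exists_generator_rankOne_of_irr (W := W) (p := p) hGZK hirr hr
  -- §2 is stated with the classical `DecidableEq`; over `ℚ` the binders carry `instDecidableEqRat`: transport with `convert`
  refine exists_sha_ne_zero_of_congr_of_witness_of_ownPoint W W' hp2 θ hθ S hS hdiv' ⟨G, fun Q ↦ ?_⟩ T
    (fun hmem ↦ hT (by convert hmem)) hloc v hTv G₀ hG₀
  obtain ⟨a, R, h⟩ := hG Q
  exact ⟨a, R, by convert h⟩

/-- **The LOWER half `ord_p #Ш(E)_an ≤ ord_p #Ш(E)` by one-witness + own-point visibility — the CONTENT-window door for a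
rank-one row with `E[p]` irreducible whose partner has `ℚ_p`-rational `p`-torsion** (`p` odd; datum `#Ш(E)_an = q`,
`ord_p q ≤ 2`). Published inputs: Cassels–Tate (`hCT`), GZK (`hGZK`). Chain: §3 visibility ⟹ `Ш(E)[p] ≠ 0` ⟹ `p ∣ #Ш(E)`
⟹ Cassels–Tate squareness (`missingLowerBoundAt_of_casselsTate_of_pow_dvd`) ⟹ `ord_p #Ш_an ≤ 2 ≤ ord_p #Ш`. Serves the
four «equality» content rows of crux #2″ in range (and any rank-one content row of any cell). Per pair; NOT a class
theorem; the crux stays OPEN. [cite: CremonaMazur2000, §3] [cite: AgasheStein2002, Lemma 3.6] [cite: SilvermanAEC2009, Thm. X.4.14] -/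
theorem missingLowerBoundAt_rankOne_irr_of_witness_of_ownPoint
    (hCT : exists_casselsTate_pairing (K := ℚ)) (hGZK : rank_eq_analyticRank_of_analyticRank_le_one)
    (hp2 : p ≠ 2) (hirr : Irr W p) (hr : W.analyticRank = 1)
    {q : ℚ} (hq : shaAn W = (q : ℂ)) (hv : padicValRat p q ≤ 2)
    (W' : WeierstrassCurve ℚ) [W'.IsElliptic]
    (θ : geomTorsion W' (p : ℤ) ≃+ geomTorsion W (p : ℤ))
    (hθ : ∀ (σ : absoluteGaloisGroup ℚ) (P : geomTorsion W' (p : ℤ)), θ (σ • P) = σ • θ P)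
    (S : Finset (HeightOneSpectrum (𝓞 ℚ)))
    (hS : ∀ w : HeightOneSpectrum (𝓞 ℚ), w ∉ S →
      W.HasGoodReductionAt w ∧ W'.HasGoodReductionAt w ∧ (p : 𝓞 ℚ) ∉ w.asIdeal)
    (hdiv' : ∀ P : geomPoints W', ∃ Q : geomPoints W', (p : ℤ) • Q = P)
    (T : W'.toAffine.Point)
    (hT : T ∉ (zsmulAddGroupHom (p : ℤ) : W'.toAffine.Point →+ W'.toAffine.Point).range)
    (hloc : ∀ w ∈ S, h1Equiv θ hθ (kummerMapTorsion W' (p : ℤ) hdiv' T) ∈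
      selmerLocalKer W (w.adicCompletion ℚ) (p : ℤ))
    (v : HeightOneSpectrum (𝓞 ℚ))
    (hTv : ∃ Q : (W'.baseChange (v.adicCompletion ℚ)).toAffine.Point,
      p • Q = WeierstrassCurve.Affine.Point.baseChange (W' := W') ℚ (v.adicCompletion ℚ) T)
    (G₀ : W.toAffine.Point)
    (hG₀ : ¬ ∃ Q : (W.baseChange (v.adicCompletion ℚ)).toAffine.Point,
      p • Q = WeierstrassCurve.Affine.Point.baseChange (W' := W) ℚ (v.adicCompletion ℚ) G₀) :
    MissingLowerBoundAt W p := by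
  have hex : ∃ c : W.sha, c ≠ 0 ∧ p • c = 0 :=
    exists_sha_ne_zero_rankOne_irr_of_witness_of_ownPoint hGZK hp2 hirr hr W' θ hθ S hS hdiv' T hT hloc v hTv G₀ hG₀
  have hfinSha : W.ShaFinite := (hGZK W (by rw [hr])).2
  exact missingLowerBoundAt_of_casselsTate_of_pow_dvd W p hCT hfinSha hq (k := 1) (by simpa using hv)
    (by simpa using dvd_shaOrder_of_exists_torsion W p hex)

end RatDoors

/-! ## §4 The own point is NOT locally `p`-divisible: the reduction certificate at a good prime -/

section NotDivisible

variable (W : WeierstrassCurve ℚ) [W.IsGloballyMinimal]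

/-- **`G₀ ∉ p·E(ℚ_ℓ)` from a reduction certificate, `p`-adic form.** For `W/ℚ` globally minimal, a good prime `ℓ ∤ Δ_W`
with `p ∣ N_ℓ = #Ẽ(𝔽_ℓ)`, and `G₀ ∈ E(ℚ)` such that `(N_ℓ/p)·G₀ = (x, y)` is affine with `ℓ ∤ den x`: `G₀|_{ℚ_ℓ}`
(`toPadicPoint`) is not `p·Q` for any `Q ∈ E(ℚ_ℓ)` — else `(N_ℓ/p)·G₀ = N_ℓ·Q ∈ E₁(ℚ_ℓ)` (`N_ℓ·E(ℚ_ℓ) ⊆ E₁(ℚ_ℓ)`,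
AEC VII.2.1, tree `isInReductionKernel_reductionPointCount_nsmul`), i.e. `‖x‖_ℓ > 1`. The LOCAL twin of
`X7VisibilityWitnessShape.not_mem_range_zsmul_of_reductionCert` (same certificate, conclusion in `E(ℚ_ℓ)` instead of `E(ℚ)`).
[cite: SilvermanAEC2009, Prop. VII.2.1] [cite: CoatesWiles1977, §6 p. 250 (proof of Lemma 35)] -/
theorem not_exists_smul_eq_toPadicPoint_of_reductionCert {p : ℕ} (ℓ : ℕ) [Fact ℓ.Prime]
    (hΔ : ¬ (ℓ : ℤ) ∣ minimalDiscriminantInt W) (hpN : p ∣ W.reductionPointCount ℓ)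
    (G₀ : W.toAffine.Point) {x y : ℚ} (h : W.toAffine.Nonsingular x y)
    (heq : (W.reductionPointCount ℓ / p) • G₀ = .some x y h) (hden : ¬ ℓ ∣ x.den) :
    ¬ ∃ Q : (W.baseChange ℚ_[ℓ]).toAffine.Point, p • Q = W.toPadicPoint ℓ G₀ := by
  rintro ⟨Q, hQ⟩
  have hcalc : W.toPadicPoint ℓ ((W.reductionPointCount ℓ / p) • G₀) = W.reductionPointCount ℓ • Q := by
    rw [map_nsmul, ← hQ, ← mul_nsmul', Nat.div_mul_cancel hpN]
  have hker := W.isInReductionKernel_reductionPointCount_nsmul (p := ℓ) hΔ Q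
  rw [← hcalc, heq, toPadicPoint_some, isInReductionKernel_some] at hker
  exact absurd (Padic.norm_rat_le_one hden) (not_le.mpr hker)

/-- **`G₀ ∉ p·E(ℚ_v)` from a reduction certificate, at the place `v` of `ℚ` over the good prime `ℓ`** (the binder `hG₀`
of §3 LITERALLY): transport of `not_exists_smul_eq_toPadicPoint_of_reductionCert` along Mathlib's continuous `ℚ`-algebra
isomorphism `adicCompletion.padicEquiv v : ℚ_v ≃A[ℚ] ℚ_[ℓ]` (`Affine.Point.map` along it is additive and maps `G₀|_{ℚ_v}`
to `G₀|_{ℚ_ℓ}`, `Affine.Point.map_baseChange`). [cite: SilvermanAEC2009, Prop. VII.2.1] -/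
theorem not_exists_smul_eq_baseChange_of_reductionCert {p : ℕ} (ℓ : ℕ) [Fact ℓ.Prime]
    {v : HeightOneSpectrum (𝓞 ℚ)} (hv : (primesEquiv v : ℕ) = ℓ)
    (hΔ : ¬ (ℓ : ℤ) ∣ minimalDiscriminantInt W) (hpN : p ∣ W.reductionPointCount ℓ)
    (G₀ : W.toAffine.Point) {x y : ℚ} (h : W.toAffine.Nonsingular x y)
    (heq : (W.reductionPointCount ℓ / p) • G₀ = .some x y h) (hden : ¬ ℓ ∣ x.den) :
    ¬ ∃ Q : (W.baseChange (v.adicCompletion ℚ)).toAffine.Point,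
      p • Q = WeierstrassCurve.Affine.Point.baseChange (W' := W) ℚ (v.adicCompletion ℚ) G₀ := by
  subst hv
  rintro ⟨Q, hQ⟩
  let ψ : v.adicCompletion ℚ →ₐ[ℚ] ℚ_[(primesEquiv v : ℕ)] :=
    ((adicCompletion.padicEquiv v) : v.adicCompletion ℚ ≃A[ℚ] ℚ_[(primesEquiv v : ℕ)])
  refine not_exists_smul_eq_toPadicPoint_of_reductionCert W (primesEquiv v : ℕ) hΔ hpN G₀ h heq hden
    ⟨WeierstrassCurve.Affine.Point.map (W' := W) ψ Q, ?_⟩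
  rw [← map_nsmul, hQ, WeierstrassCurve.Affine.Point.map_baseChange]
  rfl

end NotDivisible

end Summit.BirchSwinnertonDyer.BirchSwinnertonDyer.Theorems.VisibleOwnPoint

end
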